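import Mathlib.FieldTheory.Finite.Basic
import Mathlib.Data.Real.Basic

/-!
# Crux `DlogGraphFlat` (stmt-QuantumAdvantage-10732), line `Sketch_holder_energy` — stub `stub_heEnergyTransport`

Energy transport along the discrete logarithm. For a prime `p`, `N = p − 1` and `g : ZMod p` of
multiplicative order `N` (a primitive root), the map `x ↦ gˣ` is a group isomorphism
`ℤ/N → 𝔽_pˣ`; hence for every `F : 𝔽_p → ℝ` the additive-energy sum of the sequence `x ↦ F(gˣ)`
on `ℤ/N`, `Σ_{x₁,x₂,x₃} F(g^{x₁}) F(g^{x₂}) F(g^{x₃}) F(g^{x₁+x₂−x₃})`, equals the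
multiplicative-energy sum `Σ_{y₁,y₂,y₃ ∈ 𝔽_pˣ} F(y₁) F(y₂) F(y₃) F(y₁ y₂ y₃⁻¹)` of `F`.

Proof. `g ≠ 0` (the order of `0` is `0 ≠ N`), so `g` is a unit `u` with `orderOf u = N`. The map
`x ↦ u ^ x.val : ZMod N → (ZMod p)ˣ` is injective (`pow_injOn_Iio_orderOf`, as `x.val < N`)
between types of the same cardinality `N = p − 1` (`ZMod.card`, `ZMod.card_units`), hence
bijective, and `u ^ (x₁ + x₂ − x₃).val · u ^ x₃.val = u ^ x₁.val · u ^ x₂.val` because the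
exponents agree modulo `N = orderOf u` (`pow_eq_pow_iff_modEq`, `ZMod.natCast_eq_natCast_iff`).
Reindexing the three sums along this bijection (`Fintype.sum_bijective`) gives the claim.
-/

set_option linter.dupNamespace false -- D-0017: single-problem summit ⇒ `QuantumAdvantage.QuantumAdvantage` by design

namespace Summit.QuantumAdvantage.QuantumAdvantage.Theorems.SymplecticPurity

open Finset

namespace HeEnergyTransport

/-- An element of `ZMod p` (`p` prime) whose multiplicative order is a non-zero `N` is non-zero,
since the order of `0` is `0`. [folklore] -/
theorem ne_zero_of_orderOf_eq {p : ℕ} [Fact p.Prime] {N : ℕ} [NeZero N] {g : ZMod p}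
    (hg : orderOf g = N) : g ≠ 0 := by
  rintro rfl
  rw [orderOf_zero] at hg
  exact NeZero.ne N hg.symm

/-- The discrete exponential `x ↦ u ^ x.val` on `ZMod N`, `N = orderOf u`, is a homomorphism in the
form needed for energies: `u ^ (x₁ + x₂ - x₃).val * u ^ x₃.val = u ^ x₁.val * u ^ x₂.val`
(the exponents agree modulo the order of `u`). [folklore] -/
theorem pow_val_add_sub_mul {G : Type*} [Group G] {N : ℕ} [NeZero N] (u : G)
    (hu : orderOf u = N) (x₁ x₂ x₃ : ZMod N) :
    u ^ (x₁ + x₂ - x₃).val * u ^ x₃.val = u ^ x₁.val * u ^ x₂.val := by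
  rw [← pow_add, ← pow_add, pow_eq_pow_iff_modEq, hu, ← ZMod.natCast_eq_natCast_iff]
  simp only [Nat.cast_add, ZMod.natCast_zmod_val, sub_add_cancel]

/-- The discrete exponential in the multiplicative form used for energies:
`u ^ x₁.val * u ^ x₂.val * (u ^ x₃.val)⁻¹ = u ^ (x₁ + x₂ - x₃).val` when `orderOf u = N`.
[folklore] -/
theorem pow_val_mul_pow_val_mul_inv {G : Type*} [Group G] {N : ℕ} [NeZero N] (u : G)
    (hu : orderOf u = N) (x₁ x₂ x₃ : ZMod N) :
    u ^ x₁.val * u ^ x₂.val * (u ^ x₃.val)⁻¹ = u ^ (x₁ + x₂ - x₃).val := by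
  rw [mul_inv_eq_iff_eq_mul]
  exact (pow_val_add_sub_mul u hu x₁ x₂ x₃).symm

/-- For a unit `u` of `ZMod p` (`p` prime) of order `N = p - 1`, the discrete exponential
`x ↦ u ^ x.val : ZMod N → (ZMod p)ˣ` is a bijection: it is injective below the order
(`pow_injOn_Iio_orderOf`) and both types have `p - 1` elements. [folklore] -/
theorem bijective_pow_val {p : ℕ} [Fact p.Prime] {N : ℕ} [NeZero N] (u : (ZMod p)ˣ)
    (hu : orderOf u = N) (hN : N = p - 1) :
    Function.Bijective fun x : ZMod N => u ^ x.val := by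
  rw [Fintype.bijective_iff_injective_and_card]
  refine ⟨fun x y hxy => ?_, by rw [ZMod.card, ZMod.card_units, hN]⟩
  apply ZMod.val_injective
  refine pow_injOn_Iio_orderOf (x := u) ?_ ?_ hxy
  · rw [Set.mem_Iio, hu]; exact ZMod.val_lt x
  · rw [Set.mem_Iio, hu]; exact ZMod.val_lt y

end HeEnergyTransport

open HeEnergyTransport in
/-- **Stub B3 (energy transport along the discrete logarithm).** For a prime `p`, `N = p − 1`
and `g : ZMod p` of order `N`, and every `F : ZMod p → ℝ`, the additive-energy sum of
`x ↦ F (g ^ x.val)` over `ZMod N` equals the multiplicative-energy sum of `F` over `(ZMod p)ˣ`: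
`x ↦ gˣ` is a group isomorphism `ℤ/N ≃ 𝔽_pˣ` (injective below the order, equal cardinalities,
exponents read modulo `N = orderOf g`), and the triple sum is reindexed along it. [folklore] -/
theorem stub_heEnergyTransport : ∀ (p : ℕ) [Fact (Nat.Prime p)] (N : ℕ) [NeZero N] (g : ZMod p),
    orderOf g = N → N = p - 1 → ∀ F : ZMod p → ℝ,
    ∑ x₁ : ZMod N, ∑ x₂ : ZMod N, ∑ x₃ : ZMod N,
        F (g ^ x₁.val) * F (g ^ x₂.val) * F (g ^ x₃.val) * F (g ^ (x₁ + x₂ - x₃).val) =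
      ∑ y₁ : (ZMod p)ˣ, ∑ y₂ : (ZMod p)ˣ, ∑ y₃ : (ZMod p)ˣ,
        F (y₁ : ZMod p) * F (y₂ : ZMod p) * F (y₃ : ZMod p) *
          F ((y₁ * y₂ * y₃⁻¹ : (ZMod p)ˣ) : ZMod p) := by
  intro p _ N _ g hg hN F
  -- `g` is a unit `u` of order `N`
  obtain ⟨u, rfl⟩ : ∃ u : (ZMod p)ˣ, (u : ZMod p) = g :=
    ⟨Units.mk0 g (ne_zero_of_orderOf_eq hg), Units.val_mk0 _⟩
  rw [orderOf_units] at hg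
  -- reindex the three sums along the bijection `x ↦ u ^ x.val`
  have he := bijective_pow_val u hg hN
  refine Fintype.sum_bijective _ he _ _ fun x₁ => ?_
  refine Fintype.sum_bijective _ he _ _ fun x₂ => ?_
  refine Fintype.sum_bijective _ he _ _ fun x₃ => ?_
  simp only [pow_val_mul_pow_val_mul_inv u hg, Units.val_pow_eq_pow_val]

end Summit.QuantumAdvantage.QuantumAdvantage.Theorems.SymplecticPurity
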